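import Summits.QuantumFields.GaugeBoot.CubicTorusLinkRPAnyBeta
import Summits.QuantumFields.GaugeBoot.DiagonalRPTorusGaugeInvariantFour
import Summits.QuantumFields.GaugeBoot.DiagonalRPTorusOddStaircase
import HarnessLib

/-!
# On EVEN two-tori the gauge-invariant diagonal RP holds at EVERY real `β` for `SU(2n)`, `U(N)`:
the staggered central twist commutes with the swap up to a gauge transformation
(gauge-boot, L3(ζ) at `β < 0`)

HONEST FRAMING (cell `pub-gaugeboot`, page 1 of every file): the venture produces certified bounds
on lattice expectations at stated coupling, gauge group, dimension and torus size; NOT a mass gap,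
NOT a continuum limit, NOT a string tension; NOT Yang–Mills-summit-bearing (barriers
`FixedCouplingUltralocality`, `PerturbativeInvisibility`). A small POSITIVE structural result about
which positivity constraints a two-dimensional TORUS certificate may use; no two-dimensional
certificate with a diagonal block exists or is planned.

## Content

`DiagonalRPTorusGaugeInvariantFour/Two` proved `GaugeInvariantDiagonalRP ρ β i j` on `(ℤ/L)²`,
`L ≥ 4` even, for `β ≥ 0`. `StaggeredCentralTwist` recorded why the Kogut–Susskind staggered
central twist `T_r` (`U_l ↦ z^{c_r(l)} U_l`, `ρ z = -1`, which maps the Wilson measure at `β` onto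
the one at `-β`) does NOT transfer the DIAGONAL family: no swap-symmetric staggering exists. For
GAUGE-INVARIANT observables it does: in two dimensions the two staggerings `T_i` (twist the
`i`-links by `z^{x_j}`) and `T_j` (twist the `j`-links by `z^{x_i}`) are exchanged by the swap,
`Θ ∘ T_j = T_i ∘ Θ` (`configDiagSwap_centralTwist_stagTwist`), and DIFFER BY A GAUGE TRANSFORMATION,
`T_i = (x ↦ z^{x_i x_j}) · T_j` (`centralTwist_stagTwist_eq_gaugeTransform`). Hence for a
gauge-invariant closed-half observable `F`, `⟨(ΘF)‾F⟩_{-β} = ⟨(Θ(F∘T_j))‾ (F∘T_j)⟩_β` with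
`F ∘ T_j` again gauge invariant and supported in the closed half:

* ★★★ **`DiagRPTwo.gaugeInvariantDiagonalRP_two_even_allBeta`** — `G` compact metrisable with a
  central `z`, `z² = 1`, `ρ` continuous with `ρ z = -1`; `(ℤ/L)²` with `L ≥ 4` EVEN; `i ≠ j`;
  EVERY real `β`: `GaugeInvariantDiagonalRP ρ β i j`. `_su2n` (`SU(M)`, `M` even, e.g. `SU(2)`),
  `_uN` (`U(N)`, `N ≥ 1`).

With `DiagonalRPTorusOddGaugeInvariantNegative` (odd `L ≥ 5`: gauge-invariant RP `↔ 0 ≤ β`) this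
gives the PARITY DICHOTOMY of the gauge-invariant sector at negative coupling for these groups; with
`not_diagonalReflectionPositive_two` (even `L`: the full closed-half RP fails at every `β ≠ 0`) it
shows that on even two-tori the diagonal obstruction is a pure gauge artefact at EVERY coupling.
NOT claimed: `SU(3)`/`SU(2n+1)` on even tori at `β < 0` (no central `z` with `ρ z = -1`; open),
`L = 2`, `d ≥ 3` (there the gauge-invariant statement fails at every `β`,
`not_gaugeInvariantDiagonalRP`). Elementary. [folklore] tools (Li–Meurice 2005 §II for the twist).
-/

open MeasureTheory Complex
open scoped ComplexOrder

namespace Summit.QuantumFields.GaugeBoot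

noncomputable section

open Literature.MathematicalPhysics.QuantumFieldTheory
open Literature.MathematicalPhysics.QuantumLattice (fundamentalRep unitaryFundamentalRep
  continuous_fundamentalRep continuous_unitaryFundamentalRep)
open Literature.RepresentationTheory.CompactGroups

namespace DiagRPTwo

open TiltedRP

/-! ## The two staggerings of the even two-torus -/

section Twist

variable {L : ℕ} {G : Type*} [Group G] {i j : Fin 2}

/-- In two dimensions the staggered parity with `j` last vanishes on `i`-links. -/
theorem stagParity_two_fst (h2 : 2 ∣ L) (hij : i ≠ j) (x : Site 2 L) :
    stagParity (cubicParity 2 L h2) j (x, i) = 0 := by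
  unfold stagParity
  refine Finset.sum_eq_zero fun m hm => ?_
  rw [Finset.mem_filter] at hm
  obtain ⟨-, hmj, hlt⟩ := hm
  rcases hlt with h | h
  · exact absurd h hij
  · rcases eq_or_eq_of_ne hij m with rfl | rfl
    · exact absurd h (lt_irrefl _)
    · exact absurd rfl hmj

/-- In two dimensions the staggered parity with `j` last is `x_i (mod 2)` on `j`-links. -/
theorem stagParity_two_snd (h2 : 2 ∣ L) (hij : i ≠ j) (x : Site 2 L) :
    stagParity (cubicParity 2 L h2) j (x, j) = cubicParity 2 L h2 i x := by
  unfold stagParity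
  have hfilter : (Finset.univ.filter fun m' => PrecLast j m' j) = {i} := by
    ext m
    simp only [Finset.mem_filter, Finset.mem_univ, true_and, PrecLast, true_or, and_true,
      Finset.mem_singleton]
    rcases eq_or_eq_of_ne hij m with rfl | rfl
    · simp [hij]
    · simp [hij.symm]
  rw [hfilter, Finset.sum_singleton]

/-- The twist weights with `j` last: trivial on `i`-links, `z^{x_i}` on `j`-links. -/
theorem stagTwist_two_fst (h2 : 2 ∣ L) (hij : i ≠ j) (z : G) (x : Site 2 L) :
    stagTwist (cubicParity 2 L h2) j z (x, i) = 1 := by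
  rw [stagTwist, stagParity_two_fst h2 hij, zpow₂, if_neg (by decide)]

/-- The twist weights with `j` last on `j`-links. -/
theorem stagTwist_two_snd (h2 : 2 ∣ L) (hij : i ≠ j) (z : G) (x : Site 2 L) :
    stagTwist (cubicParity 2 L h2) j z (x, j) = zpow₂ z (cubicParity 2 L h2 i x) := by
  rw [stagTwist, stagParity_two_snd h2 hij]

/-- The parity of the swapped site: `(θx)_i = x_j (mod 2)`. -/
theorem cubicParity_siteDiagSwap (h2 : 2 ∣ L) (i j : Fin 2) (x : Site 2 L) :
    cubicParity 2 L h2 i (siteDiagSwap i j x) = cubicParity 2 L h2 j x := by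
  simp [cubicParity_apply, siteDiagSwap, Equiv.swap_apply_left]

/-- ★ **The swap exchanges the two staggerings**: `Θ (T_j U) = T_i (Θ U)`. -/
theorem configDiagSwap_centralTwist_stagTwist (h2 : 2 ∣ L) (hij : i ≠ j) (z : G) (U : GaugeConfig 2 L G) :
    configDiagSwap i j (centralTwist (stagTwist (cubicParity 2 L h2) j z) U) =
      centralTwist (stagTwist (cubicParity 2 L h2) i z) (configDiagSwap i j U) := by
  funext e
  obtain ⟨x, m⟩ := e
  simp only [configDiagSwap, centralTwist_apply, edgeDiagSwap]
  rcases eq_or_eq_of_ne hij m with rfl | rfl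
  · rw [Equiv.swap_apply_left, stagTwist_two_snd h2 hij, stagTwist_two_snd h2 hij.symm,
      cubicParity_siteDiagSwap]
  · rw [Equiv.swap_apply_right, stagTwist_two_fst h2 hij, stagTwist_two_fst h2 hij.symm]

/-- Parities of shifted sites: `π_m(x + e_k) = π_m(x) + [m = k]`. -/
theorem cubicParity_shift (h2 : 2 ∣ L) (m k : Fin 2) (x : Site 2 L) :
    cubicParity 2 L h2 m (x.shift k) = cubicParity 2 L h2 m x + if m = k then 1 else 0 := by
  rw [Site.shift, map_add]
  congr 1
  have h := isDualParity_cubicParity 2 L h2 m k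
  rwa [show cubicUnit 2 L k = Pi.single k 1 from rfl] at h

/-- `z^a` takes values in `{1, z}`, so it is central and an involution when `z` is. -/
theorem zpow₂_comm {z : G} (hzc : ∀ g, z * g = g * z) (a : ZMod 2) (g : G) :
    zpow₂ z a * g = g * zpow₂ z a := by
  unfold zpow₂; split_ifs
  · exact hzc g
  · rw [one_mul, mul_one]

/-- `(z^a)⁻¹ = z^a` for `z² = 1`. -/
theorem zpow₂_inv {z : G} (hz2 : z * z = 1) (a : ZMod 2) : (zpow₂ z a)⁻¹ = zpow₂ z a := by
  unfold zpow₂; split_ifs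
  · exact inv_eq_of_mul_eq_one_right hz2
  · exact inv_one

/-- ★ **The two staggerings differ by a gauge transformation**: `T_i U = (z^{x_i x_j}) · (T_j U)`
(`z` central, `z² = 1`). -/
theorem centralTwist_stagTwist_eq_gaugeTransform (h2 : 2 ∣ L) (hij : i ≠ j) {z : G}
    (hzc : ∀ g, z * g = g * z) (hz2 : z * z = 1) (U : GaugeConfig 2 L G) :
    centralTwist (stagTwist (cubicParity 2 L h2) i z) U =
      gaugeTransform (fun x => zpow₂ z (cubicParity 2 L h2 i x * cubicParity 2 L h2 j x))
        (centralTwist (stagTwist (cubicParity 2 L h2) j z) U) := by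
  have h2' : ∀ a : ZMod 2, a + a = 0 := by decide
  funext e
  obtain ⟨x, m⟩ := e
  simp only [gaugeTransform, centralTwist_apply, zpow₂_inv hz2]
  set a := cubicParity 2 L h2 i x with ha
  set b := cubicParity 2 L h2 j x with hb
  -- collect the central weights in front of `U (x, m)`
  have hcoll : ∀ (p q r : ZMod 2) (g : G),
      zpow₂ z p * (zpow₂ z q * g) * zpow₂ z r = zpow₂ z (p + q + r) * g := by
    intro p q r g
    rw [zpow₂_add hz2, zpow₂_add hz2, mul_assoc (zpow₂ z p), mul_assoc (zpow₂ z q),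
      ← zpow₂_comm hzc r g]
    simp only [mul_assoc]
  rcases eq_or_eq_of_ne hij m with rfl | rfl
  · rw [stagTwist_two_snd h2 hij.symm, stagTwist_two_fst h2 hij,
      show (1 : G) = zpow₂ z 0 from (if_neg (by decide)).symm, hcoll, cubicParity_shift,
      cubicParity_shift, if_pos rfl, if_neg hij.symm, add_zero, ← ha, ← hb]
    congr 2
    linear_combination (-1 : ZMod 2) * h2' (a * b)
  · rw [stagTwist_two_fst h2 hij.symm, stagTwist_two_snd h2 hij, hcoll, cubicParity_shift,
      cubicParity_shift, if_neg hij, if_pos rfl, add_zero, ← ha, ← hb,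
      show (1 : G) = zpow₂ z 0 from (if_neg (by decide)).symm]
    congr 2
    linear_combination (-1 : ZMod 2) * h2' (a * b) - h2' a

/-- Central twists commute with gauge transformations. -/
theorem centralTwist_gaugeTransform {s : Edge 2 L → G} (hs : ∀ l g, s l * g = g * s l)
    (k : Site 2 L → G) (U : GaugeConfig 2 L G) :
    centralTwist s (gaugeTransform k U) = gaugeTransform k (centralTwist s U) := by
  funext e
  simp only [gaugeTransform, centralTwist_apply, ← mul_assoc, hs e (k e.1)]

/-- A gauge-invariant observable stays gauge invariant after a central twist. -/
theorem isGaugeInvariant_comp_centralTwist {α : Type*} {s : Edge 2 L → G}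
    (hs : ∀ l g, s l * g = g * s l) {F : GaugeConfig 2 L G → α} (hF : IsGaugeInvariant F) :
    IsGaugeInvariant (fun U => F (centralTwist s U)) := fun k U => by
  simp only [centralTwist_gaugeTransform hs, hF k]

/-- A closed-half observable stays a closed-half observable after a (linkwise) central twist. -/
theorem isDiagonalHalfObservable_comp_centralTwist {α : Type*} (s : Edge 2 L → G)
    {F : GaugeConfig 2 L G → α} (hF : IsDiagonalHalfObservable i j F) :
    IsDiagonalHalfObservable i j (fun U => F (centralTwist s U)) := fun U V hUV =>
  hF _ _ fun e h1 h2 => by simp only [centralTwist_apply, hUV e h1 h2]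

end Twist

/-! ## The transfer `β ↦ -β` for gauge-invariant observables -/

section Main

variable {L N : ℕ} [NeZero L] {G : Type} [Group G] [TopologicalSpace G] [IsTopologicalGroup G]
  [CompactSpace G] [MeasurableSpace G] [BorelSpace G] [SecondCountableTopology G]
  (ρ : G →* Matrix (Fin N) (Fin N) ℂ) {i j : Fin 2}

/-- ★★ **Transfer of the gauge-invariant diagonal RP from `-β` to `β`** (`L` even, central `z`
with `z² = 1` and `ρ z = -1`). -/
theorem gaugeInvariantDiagonalRP_of_neg (hL : Even L) (hij : i ≠ j) (hρ : Continuous ρ) {z : G}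
    (hzc : ∀ g, z * g = g * z) (hz2 : z * z = 1) (hρz : ρ z = -1) {β : ℝ}
    (h : GaugeInvariantDiagonalRP (d := 2) (L := L) ρ (-β) i j) :
    GaugeInvariantDiagonalRP (d := 2) (L := L) ρ β i j := by
  have h2 : 2 ∣ L := even_iff_two_dvd.1 hL
  intro F hF hFb hFH hFg
  have hsc : ∀ (l : Edge 2 L) (g : G), stagTwist (cubicParity 2 L h2) j z l * g =
      g * stagTwist (cubicParity 2 L h2) j z l := fun l g => zpow₂_comm hzc _ g
  -- the twisted observable `F ∘ T_j`
  have hF' : Measurable fun U => F (centralTwist (stagTwist (cubicParity 2 L h2) j z) U) :=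
    hF.comp (measurable_centralTwist _)
  have hFb' : ∃ C : ℝ, ∀ U, ‖F (centralTwist (stagTwist (cubicParity 2 L h2) j z) U)‖ ≤ C := by
    obtain ⟨C, hC⟩ := hFb; exact ⟨C, fun U => hC _⟩
  have hFH' : IsDiagonalHalfObservable i j fun U =>
      F (centralTwist (stagTwist (cubicParity 2 L h2) j z) U) :=
    isDiagonalHalfObservable_comp_centralTwist _ hFH
  have hFg' : IsGaugeInvariant fun U => F (centralTwist (stagTwist (cubicParity 2 L h2) j z) U) :=
    isGaugeInvariant_comp_centralTwist hsc hFg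
  have hpos := h _ hF' hFb' hFH' hFg'
  -- `Θ (T_j U) = T_i (Θ U) = gauge · T_j (Θ U)`, and `F` is gauge invariant
  have hswap : ∀ U : GaugeConfig 2 L G,
      F (configDiagSwap i j (centralTwist (stagTwist (cubicParity 2 L h2) j z) U)) =
        F (centralTwist (stagTwist (cubicParity 2 L h2) j z) (configDiagSwap i j U)) := by
    intro U
    rw [configDiagSwap_centralTwist_stagTwist h2 hij,
      centralTwist_stagTwist_eq_gaugeTransform h2 hij hzc hz2, hFg]
  -- the twist maps `μ_{-β}` to `μ_β`
  have key := cubicTorus_integral_comp_stagTwist (d := 2) (L := L) ρ h2 j hρ hzc hz2 hρz (-β)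
    (fun U => (starRingEnd ℂ) (F (configDiagSwap i j U)) * F U)
  rw [neg_neg] at key
  unfold wilsonExpectation at hpos ⊢
  rw [← key]
  simp only [hswap]
  exact hpos

/-- ★★★ **EVEN two-tori: the gauge-invariant diagonal RP holds at EVERY real `β`** for a compact
metrisable `G` with a central `z`, `z² = 1`, and a continuous `ρ` with `ρ z = -1` (`SU(2)`,
`SU(2n)`, `U(N)` in the fundamental representation); `(ℤ/L)²` with `L ≥ 4` even, `i ≠ j`. -/
theorem gaugeInvariantDiagonalRP_two_even_allBeta (hL : Even L) (h4 : 4 ≤ L) (hij : i ≠ j)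
    (hρ : Continuous ρ) {z : G} (hzc : ∀ g, z * g = g * z) (hz2 : z * z = 1) (hρz : ρ z = -1)
    (β : ℝ) : GaugeInvariantDiagonalRP (d := 2) (L := L) ρ β i j := by
  rcases le_or_gt 0 β with hβ | hβ
  · exact gaugeInvariantDiagonalRP_two_of_four_le ρ hL h4 hρ hβ hij
  · exact gaugeInvariantDiagonalRP_of_neg ρ hL hij hρ hzc hz2 hρz
      (gaugeInvariantDiagonalRP_two_of_four_le ρ hL h4 hρ (by linarith) hij)

end Main

/-! ## The venture's gauge groups with a central involution -/

section Groups

/-- ★★★ **`SU(M)`, `M` even (so `SU(2)`), on `(ℤ/L)²` with `L ≥ 4` even: the gauge-invariant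
diagonal RP holds at every real `β`.** -/
theorem gaugeInvariantDiagonalRP_two_even_allBeta_su2n {L M : ℕ} [NeZero L] (hL : Even L)
    (h4 : 4 ≤ L) (hM : Even M) {i j : Fin 2} (hij : i ≠ j) (β : ℝ) :
    GaugeInvariantDiagonalRP (d := 2) (L := L) (fundamentalRep (Fin M)) β i j := by
  haveI : SecondCountableTopology (Matrix (Fin M) (Fin M) ℂ) :=
    inferInstanceAs (SecondCountableTopology (Fin M → Fin M → ℂ))
  haveI : SecondCountableTopology (Matrix.specialUnitaryGroup (Fin M) ℂ) :=
    Topology.IsEmbedding.subtypeVal.secondCountableTopology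
  set z : Matrix.specialUnitaryGroup (Fin M) ℂ := ⟨-1, neg_one_mem_specialUnitaryGroup_of_even hM⟩
    with hz
  have hzc : ∀ g, z * g = g * z := fun g => Subtype.ext (by simp [hz])
  have hz2 : z * z = 1 := Subtype.ext (by simp [hz])
  have hρz : fundamentalRep (Fin M) z = -1 := rfl
  exact gaugeInvariantDiagonalRP_two_even_allBeta (fundamentalRep (Fin M)) hL h4 hij
    (continuous_fundamentalRep (Fin M)) hzc hz2 hρz β

/-- ★★★ **`U(N)`, `N ≥ 1` (so `U(1)`), on `(ℤ/L)²` with `L ≥ 4` even: the gauge-invariant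
diagonal RP holds at every real `β`.** -/
theorem gaugeInvariantDiagonalRP_two_even_allBeta_uN {L N : ℕ} [NeZero L] (hL : Even L)
    (h4 : 4 ≤ L) {i j : Fin 2} (hij : i ≠ j) (β : ℝ) :
    GaugeInvariantDiagonalRP (d := 2) (L := L) (unitaryFundamentalRep (Fin N) ℂ) β i j := by
  haveI : SecondCountableTopology (Matrix (Fin N) (Fin N) ℂ) :=
    inferInstanceAs (SecondCountableTopology (Fin N → Fin N → ℂ))
  haveI : SecondCountableTopology (Matrix.unitaryGroup (Fin N) ℂ) :=
    Topology.IsEmbedding.subtypeVal.secondCountableTopology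
  set z : Matrix.unitaryGroup (Fin N) ℂ := ⟨-1, by simp [Matrix.mem_unitaryGroup_iff]⟩ with hz
  have hzc : ∀ g, z * g = g * z := fun g => Subtype.ext (by simp [hz])
  have hz2 : z * z = 1 := Subtype.ext (by simp [hz])
  have hρz : unitaryFundamentalRep (Fin N) ℂ z = -1 := rfl
  exact gaugeInvariantDiagonalRP_two_even_allBeta (unitaryFundamentalRep (Fin N) ℂ) hL h4 hij
    (continuous_unitaryFundamentalRep (n := Fin N) (𝕜 := ℂ)) hzc hz2 hρz β

end Groups

end DiagRPTwo

end

end Summit.QuantumFields.GaugeBoot
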